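import Literature.NumberTheory.LFunctions.ClassGroupLogFreeZeroSide
import Literature.NumberTheory.LFunctions.ClassGroupLogFreeLemmaBAllDegrees
import HarnessLib

/-!
# Bombieri's Théorème 14 for the class group characters, I: the zero side — every degree

Topic `Literature/NumberTheory/LFunctions`, namespace `Literature.NumberTheory.LFunctions.NumberField`.
Everything here is PROVED (theorems only; no definitions, no named facts).

The tree's `zeroSide_CG` (`ClassGroupLogFreeZeroSide.lean`) sums Lemme B for `L₀(s, χ)` over a finite set of
zeros; its degree restriction `n_K ≤ 4` is inherited from `lemmeB_classGroup` only.  With Lemme B in every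
degree (`lemmeB_classGroup_of_le`, lower bound `e^{−10}/n² · x^{−r/10}/r³` for `n_K ≤ n`) the same proof gives

* `zeroSide_CG_of_le (n)` — **the zero side for `n_K ≤ n`**: there are `A₀, r₀, C > 0` depending only on `n`
  such that for `ℒ'_v ≤ L'` on `|v| ≤ T'`, `0 < r ≤ r₀`, `rL' ≥ 1`, `1 ≤ x`, `log x ≥ A₀ L'`, `z ≤ x^{a₀/2}`,
  and any finite set `Z` of zeros of `L₀(·, χ)` (`χ ≠ 1`, `L₀ ≠ 0` on `Re s ≥ 1`) with `1 − r/2 ≤ β < 1`,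
  `|γ| + r/2 ≤ T'`: `r · (e^{−10} x^{−r/10} r^{−3}/n²) · Σ_ρ m(ρ) ≤ C (rL') ∫_{−T'}^{T'} I_χ(v) dv`.

The mean values `meanValueCG`, their integrability and the overlap count `overlap_le_CG` are the tree's.

## References

* [Bombieri1987GrandCrible] E. Bombieri, Astérisque 18 (1987), §6 Théorème 14, pp. 48–50.
* [ThornerZaman2017] J. Thorner, A. Zaman, Algebra Number Theory 11 (2017), §5.
* [Weiss1983] A. Weiss, J. reine angew. Math. 338 (1983) 56–94, Thm. 4.3.
-/

noncomputable section

open Complex Finset Filter Real MeasureTheory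
open scoped LSeries.notation ArithmeticFunction.vonMangoldt Topology Nat

namespace Literature.NumberTheory.LFunctions.NumberField

open Literature.NumberTheory.LFunctions.LogFreeLocal Literature.NumberTheory.LFunctions.LogFreeDensity
open scoped nonZeroDivisors _root_.NumberField

/-- **The zero side of Théorème 14 for `L₀(s, χ)` in every degree** (Bombieri pp. 49–50), `χ ≠ 1`,
`n_K ≤ n`, `L₀ ≠ 0` on `Re s ≥ 1`: there are `A₀, r₀, C > 0` depending only on `n` such that for
`ℒ'_v ≤ L'` on `|v| ≤ T'`,
`0 < r ≤ r₀`, `rL' ≥ 1`, `1 ≤ x`, `log x ≥ A₀ L'`, `z ≤ x^{a₀/2}`, and any finite set `Z` of zeros of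
`L₀(·, χ)` with `1 − r/2 ≤ β < 1`, `|γ| + r/2 ≤ T'`,
`r · (e^{−10} x^{−r/10} r^{−3}/n²) · Σ_{ρ ∈ Z} m(ρ) ≤ C (rL') ∫_{−T'}^{T'} I_χ(v) dv`.
[cite: Bombieri1987GrandCrible, §6 Théorème 14 (proof)] -/
theorem zeroSide_CG_of_le (n : ℕ) :
    ∃ A₀ r₀ C : ℝ, 0 < A₀ ∧ 0 < r₀ ∧ 0 < C ∧
      ∀ (K : Type*) [Field K] [NumberField K] (χ : ClassGroup (𝓞 K) →* ℂˣ), χ ≠ 1 →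
        Module.finrank ℚ K ≤ n → (∀ ρ : ℂ, classGroupLFunction₀ K χ ρ = 0 → ρ.re < 1) →
        ∀ (T' r L' x : ℝ) (z : ℕ) (Zρ : Finset ℂ),
        (∀ v : ℝ, |v| ≤ T' → lemmaAHeight K v ≤ L') → 0 < r → r ≤ r₀ → 1 ≤ r * L' → 1 ≤ x →
        A₀ * L' ≤ Real.log x → (z : ℝ) ≤ x ^ (expoB / 2) → 0 ≤ T' →
        (∀ ρ ∈ Zρ, classGroupLFunction₀ K χ ρ = 0 ∧ 1 - r / 2 ≤ ρ.re ∧ ρ.re < 1 ∧ |ρ.im| + r / 2 ≤ T') →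
          r * (Real.exp (-10) / (n : ℝ) ^ 2 * x ^ (-(r / 10)) / r ^ 3) *
              ∑ ρ ∈ Zρ, (zeroOrder (classGroupLFunction₀ K χ) ρ : ℝ) ≤
            C * (r * L') * ∫ v in (-T')..T', meanValueCG χ x z v := by
  obtain ⟨A₀, r₀, hA₀, hr₀, hB⟩ := lemmeB_classGroup_of_le n
  refine ⟨A₀, min r₀ (1 / 4), 2 * 4, hA₀, by positivity, by positivity,
    fun K _ _ χ hχ hnK hline T' r L' x z Zρ hLL' hr hrmin hu hx hlogx hz hT' hZ => ?_⟩
  classical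
  set f := classGroupLFunction₀ K χ with hf
  have hdf : Differentiable ℂ f := differentiable_classGroupLFunction₀ χ
  have hr0 : r ≤ r₀ := hrmin.trans (min_le_left _ _)
  have hr4 : r ≤ 1 / 4 := hrmin.trans (min_le_right _ _)
  set L₀ : ℝ := Real.exp (-10) / (n : ℝ) ^ 2 * x ^ (-(r / 10)) / r ^ 3 with hL₀
  set A : Set ℝ := Set.Icc (-T') T' with hA
  have hxpos : 0 < x := by linarith
  have hNX : 1 ≤ ⌊x ^ expoB⌋₊ := Nat.le_floor (by
    simp only [Nat.cast_one]; exact Real.one_le_rpow hx expoB_pos.le)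
  have hint : IntegrableOn (meanValueCG χ x z) A := integrableOn_meanValueCG χ hx z hNX _ _
  -- Lemme B at every `v` within `r/2` of the height of a zero of `Z`
  have hLB : ∀ ρ ∈ Zρ, ∀ v ∈ Set.Icc (ρ.im - r / 2) (ρ.im + r / 2), L₀ ≤ meanValueCG χ x z v := by
    intro ρ hρ v hv
    obtain ⟨h0, hβ, hβ1, hγT⟩ := hZ ρ hρ
    have hvT : |v| ≤ T' := by
      rw [Set.mem_Icc] at hv
      have h1 : |ρ.im| ≤ T' - r / 2 := by linarith
      have h2 := abs_le.1 h1
      rw [abs_le]; constructor <;> linarith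
    have hLL'v : lemmaAHeight K v ≤ L' := hLL' v hvT
    have hγ : |ρ.im - v| ≤ r / 2 := by
      rw [Set.mem_Icc] at hv; rw [abs_le]; constructor <;> linarith
    have hnorm : ‖ρ - (1 + (v : ℂ) * I)‖ ≤ r := by
      have hre : (ρ - (1 + (v : ℂ) * I)).re = ρ.re - 1 := by simp
      have him : (ρ - (1 + (v : ℂ) * I)).im = ρ.im - v := by simp
      calc ‖ρ - (1 + (v : ℂ) * I)‖ ≤ |(ρ - (1 + (v : ℂ) * I)).re| + |(ρ - (1 + (v : ℂ) * I)).im| :=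
            Complex.norm_le_abs_re_add_abs_im _
        _ ≤ r / 2 + r / 2 := by
            rw [hre, him]
            refine add_le_add ?_ hγ
            rw [abs_sub_comm, abs_of_nonneg (by linarith)]; linarith
        _ = r := by ring
    exact hB K χ hχ hnK hline v r L' x z hLL'v hr hr0 hu ⟨ρ, h0, hnorm⟩ hxpos hlogx hz
  -- per zero: `r L₀ ≤ ∫_A 𝟙_{J_ρ} I`
  have hper : ∀ ρ ∈ Zρ, r * L₀ ≤
      ∫ v in A, (Set.Icc (ρ.im - r / 2) (ρ.im + r / 2)).indicator (meanValueCG χ x z) v := by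
    intro ρ hρ
    obtain ⟨-, -, -, hγT⟩ := hZ ρ hρ
    set J : Set ℝ := Set.Icc (ρ.im - r / 2) (ρ.im + r / 2) with hJ
    have hJA : J ⊆ A := by
      intro v hv
      rw [hJ, Set.mem_Icc] at hv
      rw [hA, Set.mem_Icc]
      have h1 : |ρ.im| ≤ T' - r / 2 := by linarith
      have h2 := abs_le.1 h1
      constructor <;> linarith
    rw [setIntegral_indicator measurableSet_Icc, Set.inter_eq_right.2 hJA]
    have hvol : volume.real J = r := by
      rw [hJ, Measure.real, Real.volume_Icc, ENNReal.toReal_ofReal (by linarith)]; ring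
    have h := setIntegral_ge_of_const_le_real (c := L₀) measurableSet_Icc measure_Icc_lt_top.ne
      (fun v hv => hLB ρ hρ v hv) (hint.mono_set hJA)
    rw [hvol] at h
    linarith
  have hsum : r * L₀ * ∑ ρ ∈ Zρ, (zeroOrder f ρ : ℝ) ≤
      ∫ v in A, ∑ ρ ∈ Zρ, (zeroOrder f ρ : ℝ) *
        (Set.Icc (ρ.im - r / 2) (ρ.im + r / 2)).indicator (meanValueCG χ x z) v := by
    rw [mul_sum, integral_finsetSum _ fun ρ _ => (hint.indicator measurableSet_Icc).const_mul _]
    refine sum_le_sum fun ρ hρ => ?_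
    rw [integral_const_mul]
    have h0 : (0 : ℝ) ≤ zeroOrder f ρ := Nat.cast_nonneg _
    calc r * L₀ * (zeroOrder f ρ : ℝ) = (zeroOrder f ρ : ℝ) * (r * L₀) := by ring
      _ ≤ _ := mul_le_mul_of_nonneg_left (hper ρ hρ) h0
  refine hsum.trans ?_
  have hℒ : ∀ v ∈ A, lemmaAHeight K v ≤ L' := by
    intro v hv
    rw [hA, Set.mem_Icc] at hv
    exact hLL' v (abs_le.2 ⟨hv.1, hv.2⟩)
  have hpt : ∀ v ∈ A, ∑ ρ ∈ Zρ, (zeroOrder f ρ : ℝ) *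
      (Set.Icc (ρ.im - r / 2) (ρ.im + r / 2)).indicator (meanValueCG χ x z) v ≤
        (2 * 4 * (r * L')) * meanValueCG χ x z v := by
    intro v hv
    have heq : ∑ ρ ∈ Zρ, (zeroOrder f ρ : ℝ) *
        (Set.Icc (ρ.im - r / 2) (ρ.im + r / 2)).indicator (meanValueCG χ x z) v =
        (∑ ρ ∈ Zρ.filter (fun ρ => |ρ.im - v| ≤ r / 2), (zeroOrder f ρ : ℝ)) * meanValueCG χ x z v := by
      rw [sum_mul, sum_filter]
      refine sum_congr rfl fun ρ _ => ?_
      by_cases h : |ρ.im - v| ≤ r / 2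
      · rw [if_pos h, Set.indicator_of_mem]
        rw [Set.mem_Icc]; rw [abs_le] at h; constructor <;> linarith
      · rw [if_neg h, Set.indicator_of_notMem, mul_zero]
        rw [Set.mem_Icc]; intro h'; exact h (abs_le.2 ⟨by linarith, by linarith⟩)
    rw [heq]
    refine mul_le_mul_of_nonneg_right ?_ (meanValueCG_nonneg χ x z v)
    have h1 := overlap_le_CG hχ hr hr4 Zρ (fun ρ hρ => ⟨(hZ ρ hρ).1, (hZ ρ hρ).2.1, (hZ ρ hρ).2.2.1⟩) v
    have h2 : 4 * (1 + r * lemmaAHeight K v) ≤ 2 * 4 * (r * L') := by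
      have := hℒ v hv
      have h3 : r * lemmaAHeight K v ≤ r * L' := mul_le_mul_of_nonneg_left this hr.le
      nlinarith [hu]
    exact h1.trans h2
  have hi1 : IntegrableOn (fun v => ∑ ρ ∈ Zρ, (zeroOrder f ρ : ℝ) *
      (Set.Icc (ρ.im - r / 2) (ρ.im + r / 2)).indicator (meanValueCG χ x z) v) A :=
    integrable_finsetSum _ fun ρ _ => (hint.indicator measurableSet_Icc).const_mul _
  calc ∫ v in A, ∑ ρ ∈ Zρ, (zeroOrder f ρ : ℝ) *
        (Set.Icc (ρ.im - r / 2) (ρ.im + r / 2)).indicator (meanValueCG χ x z) v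
      ≤ ∫ v in A, (2 * 4 * (r * L')) * meanValueCG χ x z v :=
        setIntegral_mono_on hi1 (hint.const_mul _) measurableSet_Icc hpt
    _ = (2 * 4 * (r * L')) * ∫ v in (-T')..T', meanValueCG χ x z v := by
        rw [integral_const_mul, hA, integral_Icc_eq_integral_Ioc,
          ← intervalIntegral.integral_of_le (by linarith)]

end Literature.NumberTheory.LFunctions.NumberField

end
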